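import Literature.NumberTheory.Automorphic.AdelicCompactSupportTateMajorant
import Literature.NumberTheory.Automorphic.UnitaryGroupTraceZeroLine
import Literature.NumberTheory.Automorphic.UnitaryGroupHeisenbergFundamentalDomain
import Literature.NumberTheory.Automorphic.UnitaryGroupIwasawaIntegration
import Literature.NumberTheory.Automorphic.ReductionTheoryGLnConjugation
import Literature.NumberTheory.Automorphic.IdeleGroupBorel
import Mathlib.MeasureTheory.Integral.Bochner.Set
import HarnessLib

/-!
# The `K`-averaged centre profile of the unipotent term of `U(J₃)` is continuous of compact support;
# idele-side finiteness `∫_{𝕀_F} ‖y‖⁻² Φ⁺_f(y) dμ_F < ∞` (Tate at `s = 2`)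
(Rogawski, *Automorphic Representations of Unitary Groups in Three Variables* (1990), §7.3, (7.3.2) and
Prop. 7.3.2 (c)+(d), pp. 96–97: in the term `∫_{N E^* ∖ N I_E} Σ_{t ∈ F^*} ψ(t α₃(m)⁻¹ δ₀) dm` of the unipotent
class `z·𝒰`, the profile `ψ` is the `K`-average of the test function along the centre `Z(𝔸) = n(𝔸_E⁻)` of the
Heisenberg group, a continuous compactly supported function of the centre coordinate, and the `dm`-integral
converges absolutely as a Tate integral at `|·|²`; Tate, in Cassels–Fröhlich, Ch. XV, Lemma 4.2.4 / Thm. 4.3.2.)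

Topic `NumberTheory/Automorphic`; namespace `Literature.NumberTheory.Automorphic.UnitaryGroup`. THEOREMS ONLY
(no definition, no instance, no notation, no named fact, no `sorry`). Row (L5-i) (C-γ-fin)(fin-2) of the T1-qs
LAW 5 road of crux H413 (cell `pub/hodgecm-mathlib`): the input `hHfin` of ★ `lintegral_weight_mul_enorm_centrePart_lt_top`
and the `IntegrableOn (‖·‖⁻² • Φ) ↑H μ_F` input of ★ `exists_lintegral_le_and_integral_eq_of_torus_kAverage` (B)
(`UnitaryGroupUnipotentCentreLatticeAssembly`), from ★ `AdelicCompactSupportTateMajorant` read at `y⁻¹`.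
§1 (generic compact `K_U`, finite `μ_K`, any `z ∈ G(𝔸)`, `θ = traceZeroLine`): the profiles
`x ↦ ∫_{K_U} f(k⁻¹ (z n(θ x)) k) dμ_K`, `x ↦ ∫_{K_U} ‖f(k⁻¹ (z n(θ x)) k)‖ dμ_K` on `𝔸_F` are CONTINUOUS (parametric
integral over the compact `K_U`) and of COMPACT SUPPORT (support in `θ⁻¹ pr₂ n⁻¹ (z⁻¹ K (tsupport f) K⁻¹ ∩ N(𝔸))`).
§2 (letters of the (C-γ) assembly: `K_U = K ∩ G(𝔸)`, `μ_K` Haar, `μ_F` any Haar measure of `𝕀_F` for ANY Borel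
σ-algebra — bridged inside the proofs to Mathlib's `Units.instMeasurableSpace` over `borel 𝔸_F`, both being
`borel 𝕀_F`): `lintegral_ideleNorm_sq_inv_mul_centreProfile_lt_top` (+ `setLIntegral_…` = `hHfin`),
`integrable_ideleNorm_sq_inv_smul_centreProfile` (+ `integrableOn_…`, and the `(Φ, hΦ)`-letter forms).
HC_CM is proved only modulo the 7 printed citations until rung 0 closes — nothing here bears on a summit statement.

## References
* [Rogawski1990] J. D. Rogawski, *Automorphic Representations of Unitary Groups in Three Variables*, Ann. of
  Math. Stud. 123 (1990), §7.3, (7.3.2), Prop. 7.3.2 (pp. 96–97).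
* [CasselsFrohlichANT1967] J. Tate, *Fourier analysis in number fields and Hecke's zeta-functions*, in
  Cassels–Fröhlich (eds.), *Algebraic Number Theory* (1967), Ch. XV, Lemma 4.2.4, Thm. 4.3.2.
-/

set_option autoImplicit false

noncomputable section

open MeasureTheory MeasureTheory.Measure NumberField IsDedekindDomain Set Topology
open scoped ENNReal NNReal

namespace Literature.NumberTheory.Automorphic

namespace UnitaryGroup

variable {F E : Type} [Field F] [NumberField F] [Field E] [NumberField E] [Algebra F E] {c : E ≃ₐ[F] E}

/-! ## §1 Continuity and compact support of the centre profiles (generic compact `K_U`) -/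

section Profile

variable {KU : Subgroup (quasiSplit F E c 3).Adelic}

/-- `N(𝔸_F)` is closed in `G(𝔸_F)` (★ `isClosed_upperUnitriangular` pulled back along `adelicVal`; plumbing).
[cite: Rogawski1990, §1.10] -/
private theorem isClosed_adelicUnipotent₃ :
    IsClosed ((adelicUnipotent F E c 3 : Set (quasiSplit F E c 3).Adelic)) := by
  haveI : T2Space (AdeleRing (𝓞 E) E) := t2Space_adeleRing E
  change IsClosed (⇑(adelicVal F E c 3 ((StdForm.antidiagonal 3).over E)) ⁻¹'
    ((upperUnitriangular (Fin 3) (AdeleRing (𝓞 E) E) : Subgroup (GL (Fin 3) (AdeleRing (𝓞 E) E))) :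
      Set (GL (Fin 3) (AdeleRing (𝓞 E) E))))
  exact (isClosed_upperUnitriangular (R := AdeleRing (𝓞 E) E)).preimage continuous_subtype_val

variable [Algebra.IsQuadraticExtension F E]

/-- The centre embedding `x ↦ n(θ x) = heisChart (0, θ x)` of `𝔸_F` into `G(𝔸_F)` is continuous. [cite: Rogawski1990, §1.10] -/
theorem continuous_heisChart_zero_traceZeroLine (hc : c * c = 1) {δ : E} (hcδ : c δ = -δ) (hδ : δ ≠ 0) :
    Continuous fun x : AdeleRing (𝓞 F) F =>
      ((heisChart hc ((0 : AdeleRing (𝓞 E) E), traceZeroLine F E c hcδ hδ x) : adelicUnipotent F E c 3) :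
        (quasiSplit F E c 3).Adelic) :=
  continuous_subtype_val.comp ((heisChart hc).continuous.comp
    (continuous_const.prodMk (traceZeroLine F E c hcδ hδ).continuous))

/-- Joint continuity of `(x, k) ↦ f(k⁻¹ (z n(θ x)) k)` for continuous `f`. [cite: Rogawski1990, §7.3 (p. 96)] -/
private theorem continuous_conj_heisChart_uncurry (hc : c * c = 1) {δ : E} (hcδ : c δ = -δ) (hδ : δ ≠ 0)
    (z : (quasiSplit F E c 3).Adelic) {V : Type*} [TopologicalSpace V] {f : (quasiSplit F E c 3).Adelic → V}
    (hfc : Continuous f) :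
    Continuous fun p : AdeleRing (𝓞 F) F × KU =>
      f ((p.2 : (quasiSplit F E c 3).Adelic)⁻¹ * (z *
        ((heisChart hc ((0 : AdeleRing (𝓞 E) E), traceZeroLine F E c hcδ hδ p.1) : adelicUnipotent F E c 3) :
          (quasiSplit F E c 3).Adelic)) * (p.2 : (quasiSplit F E c 3).Adelic)) :=
  hfc.comp ((((continuous_subtype_val.comp continuous_snd).inv).mul
    (continuous_const.mul ((continuous_heisChart_zero_traceZeroLine hc hcδ hδ).comp continuous_fst))).mul
    (continuous_subtype_val.comp continuous_snd))

variable [MeasurableSpace (quasiSplit F E c 3).Adelic] [BorelSpace (quasiSplit F E c 3).Adelic]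

/-- **The centre profile `x ↦ ∫_{K_U} f(k⁻¹ (z n(θ x)) k) dμ_K` is continuous on `𝔸_F`** for `f` continuous, `K_U`
compact and `μ_K` finite (a parametric integral of a jointly continuous integrand over a compact set).
[cite: Rogawski1990, §7.3 (7.3.2) (p. 98)] -/
theorem continuous_integral_conj_heisChart_traceZeroLine (hc : c * c = 1) {δ : E} (hcδ : c δ = -δ) (hδ : δ ≠ 0)
    (z : (quasiSplit F E c 3).Adelic) (hK : IsCompact (KU : Set (quasiSplit F E c 3).Adelic))
    (μK : Measure KU) [IsFiniteMeasure μK] {V : Type*} [NormedAddCommGroup V] [NormedSpace ℝ V]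
    {f : (quasiSplit F E c 3).Adelic → V} (hfc : Continuous f) :
    Continuous fun x : AdeleRing (𝓞 F) F => ∫ k, f ((k : (quasiSplit F E c 3).Adelic)⁻¹ * (z *
      ((heisChart hc ((0 : AdeleRing (𝓞 E) E), traceZeroLine F E c hcδ hδ x) : adelicUnipotent F E c 3) :
        (quasiSplit F E c 3).Adelic)) * (k : (quasiSplit F E c 3).Adelic)) ∂μK := by
  haveI := locallyCompactSpace_adeleRing' F
  haveI := secondCountableTopology_adeleRing F
  haveI := secondCountableTopology_adeleRing E
  haveI : SecondCountableTopology (quasiSplit F E c 3).Adelic :=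
    inferInstanceAs (SecondCountableTopology (adelic F E c 3 ((StdForm.antidiagonal 3).over E)))
  haveI : CompactSpace KU := isCompact_iff_compactSpace.1 hK
  haveI : SecondCountableTopology KU :=
    TopologicalSpace.Subtype.secondCountableTopology (KU : Set (quasiSplit F E c 3).Adelic)
  haveI : BorelSpace KU := Subtype.borelSpace _
  have h := continuous_parametric_integral_of_continuous (μ := μK)
    (f := fun (x : AdeleRing (𝓞 F) F) (k : KU) => f ((k : (quasiSplit F E c 3).Adelic)⁻¹ * (z *
      ((heisChart hc ((0 : AdeleRing (𝓞 E) E), traceZeroLine F E c hcδ hδ x) : adelicUnipotent F E c 3) :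
        (quasiSplit F E c 3).Adelic)) * (k : (quasiSplit F E c 3).Adelic)))
    (continuous_conj_heisChart_uncurry (KU := KU) hc hcδ hδ z hfc) isCompact_univ
  simpa only [Measure.restrict_univ] using h

/-- **The absolute centre profile `x ↦ ∫_{K_U} ‖f(k⁻¹ (z n(θ x)) k)‖ dμ_K` is continuous on `𝔸_F`.**
[cite: Rogawski1990, §7.3 (7.3.2) (p. 98)] -/
theorem continuous_integral_norm_conj_heisChart_traceZeroLine (hc : c * c = 1) {δ : E} (hcδ : c δ = -δ)
    (hδ : δ ≠ 0) (z : (quasiSplit F E c 3).Adelic) (hK : IsCompact (KU : Set (quasiSplit F E c 3).Adelic))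
    (μK : Measure KU) [IsFiniteMeasure μK] {V : Type*} [NormedAddCommGroup V]
    {f : (quasiSplit F E c 3).Adelic → V} (hfc : Continuous f) :
    Continuous fun x : AdeleRing (𝓞 F) F => ∫ k, ‖f ((k : (quasiSplit F E c 3).Adelic)⁻¹ * (z *
      ((heisChart hc ((0 : AdeleRing (𝓞 E) E), traceZeroLine F E c hcδ hδ x) : adelicUnipotent F E c 3) :
        (quasiSplit F E c 3).Adelic)) * (k : (quasiSplit F E c 3).Adelic))‖ ∂μK :=
  continuous_integral_conj_heisChart_traceZeroLine hc hcδ hδ z hK μK (f := fun g => ‖f g‖) hfc.norm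

omit [MeasurableSpace (quasiSplit F E c 3).Adelic] [BorelSpace (quasiSplit F E c 3).Adelic] in
/-- **Support of the centre profile.** For `f` of compact support, `K_U` compact and any `z`, there is a compact
`T ⊆ 𝔸_F` off which `f(k⁻¹ (z n(θ x)) k) = 0` for every `k ∈ K_U`: `n(θ x) ∈ z⁻¹ K_U (tsupport f) K_U⁻¹ ∩ N(𝔸)`, a
compact set (`N(𝔸)` is closed), read back through the homeomorphisms `heisChart` and `θ`.
[cite: Rogawski1990, §7.3 (pp. 96–97)] -/
theorem exists_isCompact_forall_conj_heisChart_traceZeroLine_eq_zero (hc : c * c = 1) {δ : E} (hcδ : c δ = -δ)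
    (hδ : δ ≠ 0) (z : (quasiSplit F E c 3).Adelic) (hK : IsCompact (KU : Set (quasiSplit F E c 3).Adelic))
    {V : Type*} [Zero V] [TopologicalSpace V] {f : (quasiSplit F E c 3).Adelic → V} (hf : HasCompactSupport f) :
    ∃ T : Set (AdeleRing (𝓞 F) F), IsCompact T ∧ ∀ x ∉ T, ∀ k : KU,
      f ((k : (quasiSplit F E c 3).Adelic)⁻¹ * (z *
        ((heisChart hc ((0 : AdeleRing (𝓞 E) E), traceZeroLine F E c hcδ hδ x) : adelicUnipotent F E c 3) :
          (quasiSplit F E c 3).Adelic)) * (k : (quasiSplit F E c 3).Adelic)) = 0 := by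
  -- the compact set `z⁻¹ K (tsupport f) K⁻¹` in `G(𝔸)` and its trace on `N(𝔸)`
  set S₀ : Set (quasiSplit F E c 3).Adelic :=
    (fun p : (quasiSplit F E c 3).Adelic × (quasiSplit F E c 3).Adelic => z⁻¹ * (p.1 * p.2 * p.1⁻¹)) ''
      ((KU : Set (quasiSplit F E c 3).Adelic) ×ˢ tsupport f) with hS₀
  have hS₀c : IsCompact S₀ :=
    (hK.prod hf.isCompact).image (continuous_const.mul ((continuous_fst.mul continuous_snd).mul continuous_fst.inv))
  have hSc : IsCompact (Subtype.val ⁻¹' S₀ : Set (adelicUnipotent F E c 3)) :=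
    (isClosed_adelicUnipotent₃.isClosedEmbedding_subtypeVal).isCompact_preimage hS₀c
  -- read back along the continuous left inverse `u ↦ θ⁻¹ (pr₂ (heisChart⁻¹ u))` of `x ↦ n(θ x)`
  set r : adelicUnipotent F E c 3 → AdeleRing (𝓞 F) F :=
    fun u => (traceZeroLine F E c hcδ hδ).symm ((heisChart hc).symm u).2 with hr
  have hrc : Continuous r :=
    (traceZeroLine F E c hcδ hδ).symm.continuous.comp (continuous_snd.comp (heisChart hc).symm.continuous)
  refine ⟨r '' (Subtype.val ⁻¹' S₀), hSc.image hrc, fun x hx k => ?_⟩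
  by_contra hne
  apply hx
  refine ⟨heisChart hc ((0 : AdeleRing (𝓞 E) E), traceZeroLine F E c hcδ hδ x), ?_, ?_⟩
  · refine ⟨((k : (quasiSplit F E c 3).Adelic), (k : (quasiSplit F E c 3).Adelic)⁻¹ * (z *
        ((heisChart hc ((0 : AdeleRing (𝓞 E) E), traceZeroLine F E c hcδ hδ x) : adelicUnipotent F E c 3) :
          (quasiSplit F E c 3).Adelic)) * (k : (quasiSplit F E c 3).Adelic)), ⟨k.2, subset_tsupport _ hne⟩, ?_⟩
    show z⁻¹ * ((k : (quasiSplit F E c 3).Adelic) * ((k : (quasiSplit F E c 3).Adelic)⁻¹ * (z *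
        ((heisChart hc ((0 : AdeleRing (𝓞 E) E), traceZeroLine F E c hcδ hδ x) : adelicUnipotent F E c 3) :
          (quasiSplit F E c 3).Adelic)) * (k : (quasiSplit F E c 3).Adelic)) * (k : (quasiSplit F E c 3).Adelic)⁻¹) = _
    group
  · show (traceZeroLine F E c hcδ hδ).symm ((heisChart hc).symm (heisChart hc ((0 : AdeleRing (𝓞 E) E),
      traceZeroLine F E c hcδ hδ x))).2 = x
    rw [Homeomorph.symm_apply_apply]
    exact (traceZeroLine F E c hcδ hδ).symm_apply_apply x

omit [MeasurableSpace (quasiSplit F E c 3).Adelic] [BorelSpace (quasiSplit F E c 3).Adelic] in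
/-- **The centre profile `x ↦ ∫_{K_U} f(k⁻¹ (z n(θ x)) k) dμ_K` has compact support** for `f` of compact support and
`K_U` compact. [cite: Rogawski1990, §7.3 (7.3.2) (p. 98)] -/
theorem hasCompactSupport_integral_conj_heisChart_traceZeroLine [MeasurableSpace KU] (hc : c * c = 1) {δ : E}
    (hcδ : c δ = -δ) (hδ : δ ≠ 0) (z : (quasiSplit F E c 3).Adelic)
    (hK : IsCompact (KU : Set (quasiSplit F E c 3).Adelic)) (μK : Measure KU)
    {V : Type*} [NormedAddCommGroup V] [NormedSpace ℝ V] {f : (quasiSplit F E c 3).Adelic → V}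
    (hf : HasCompactSupport f) :
    HasCompactSupport fun x : AdeleRing (𝓞 F) F => ∫ k, f ((k : (quasiSplit F E c 3).Adelic)⁻¹ * (z *
      ((heisChart hc ((0 : AdeleRing (𝓞 E) E), traceZeroLine F E c hcδ hδ x) : adelicUnipotent F E c 3) :
        (quasiSplit F E c 3).Adelic)) * (k : (quasiSplit F E c 3).Adelic)) ∂μK := by
  haveI : T2Space (AdeleRing (𝓞 F) F) := t2Space_adeleRing F
  obtain ⟨T, hTc, hT⟩ := exists_isCompact_forall_conj_heisChart_traceZeroLine_eq_zero (KU := KU) hc hcδ hδ z hK hf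
  refine HasCompactSupport.intro hTc fun x hx => ?_
  simp_rw [hT x hx, integral_zero]

omit [MeasurableSpace (quasiSplit F E c 3).Adelic] [BorelSpace (quasiSplit F E c 3).Adelic] in
/-- **The absolute centre profile `x ↦ ∫_{K_U} ‖f(k⁻¹ (z n(θ x)) k)‖ dμ_K` has compact support.**
[cite: Rogawski1990, §7.3 (7.3.2) (p. 98)] -/
theorem hasCompactSupport_integral_norm_conj_heisChart_traceZeroLine [MeasurableSpace KU] (hc : c * c = 1) {δ : E}
    (hcδ : c δ = -δ) (hδ : δ ≠ 0) (z : (quasiSplit F E c 3).Adelic)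
    (hK : IsCompact (KU : Set (quasiSplit F E c 3).Adelic)) (μK : Measure KU)
    {V : Type*} [NormedAddCommGroup V] {f : (quasiSplit F E c 3).Adelic → V} (hf : HasCompactSupport f) :
    HasCompactSupport fun x : AdeleRing (𝓞 F) F => ∫ k, ‖f ((k : (quasiSplit F E c 3).Adelic)⁻¹ * (z *
      ((heisChart hc ((0 : AdeleRing (𝓞 E) E), traceZeroLine F E c hcδ hδ x) : adelicUnipotent F E c 3) :
        (quasiSplit F E c 3).Adelic)) * (k : (quasiSplit F E c 3).Adelic))‖ ∂μK :=
  hasCompactSupport_integral_conj_heisChart_traceZeroLine hc hcδ hδ z hK μK (f := fun g => ‖f g‖) hf.norm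

end Profile

/-! ## §2 Idele-side finiteness (Tate at `σ = 2`) in the letters of the (C-γ) assembly -/

section Idele

/-- `(‖y‖²)⁻¹ = ‖y‖^(-2)` for the idele norm, as extended non-negative reals. [folklore] -/
private theorem coe_ideleNorm_sq_inv_eq_ofReal_rpow (y : (AdeleRing (𝓞 F) F)ˣ) :
    (((IdeleClassGroup.ideleNorm F y ^ 2)⁻¹ : ℝ≥0) : ℝ≥0∞) =
      ENNReal.ofReal (((IdeleClassGroup.ideleNorm F y : ℝ≥0) : ℝ) ^ (-(2 : ℝ))) := by
  rw [Real.rpow_neg (NNReal.coe_nonneg _), show (2 : ℝ) = ((2 : ℕ) : ℝ) by norm_num, Real.rpow_natCast,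
    ← NNReal.coe_pow, ← NNReal.coe_inv, ENNReal.ofReal_coe_nnreal]

/-- `((‖y‖²)⁻¹ : ℝ) = ‖y‖^(-2)` for the idele norm. [folklore] -/
private theorem coe_ideleNorm_sq_inv_eq_rpow (y : (AdeleRing (𝓞 F) F)ˣ) :
    (((IdeleClassGroup.ideleNorm F y ^ 2)⁻¹ : ℝ≥0) : ℝ) =
      ((IdeleClassGroup.ideleNorm F y : ℝ≥0) : ℝ) ^ (-(2 : ℝ)) := by
  rw [Real.rpow_neg (NNReal.coe_nonneg _), show (2 : ℝ) = ((2 : ℕ) : ℝ) by norm_num, Real.rpow_natCast,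
    NNReal.coe_inv, NNReal.coe_pow]

variable [MeasurableSpace (quasiSplit F E c 3).Adelic]

/-- The standard maximal compact `K_U = K ∩ G(𝔸)` is a compact space and its Haar measures are finite (plumbing).
[cite: Rogawski1990, §7.3 (p. 96)] -/
private theorem isFiniteMeasure_of_isHaarMeasure_KU
    (μK : Measure ((standardMaximalCompactGL 3 E).comap
      (adelicVal F E c 3 ((StdForm.antidiagonal 3).over E)) : Subgroup (quasiSplit F E c 3).Adelic))
    [μK.IsHaarMeasure] : IsFiniteMeasure μK := by
  haveI : CompactSpace ((standardMaximalCompactGL 3 E).comap (adelicVal F E c 3 ((StdForm.antidiagonal 3).over E)) :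
      Subgroup (quasiSplit F E c 3).Adelic) :=
    isCompact_iff_compactSpace.1 isCompact_comap_adelicVal_standardMaximalCompactGL
  exact CompactSpace.isFiniteMeasure

variable [Algebra.IsQuadraticExtension F E] [BorelSpace (quasiSplit F E c 3).Adelic]
  [MeasurableSpace (AdeleRing (𝓞 F) F)ˣ] [BorelSpace (AdeleRing (𝓞 F) F)ˣ]

/-- **IDELE-SIDE FINITENESS OF THE ABSOLUTE CENTRE PROFILE (Tate at `s = 2`).** For `f` continuous of compact support
on `G(𝔸_F)`, any `z ∈ G(𝔸_F)`, a Haar measure `μ_K` of `K_U` and any Haar measure `μ_F` of `𝕀_F`: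
`∫⁻_{𝕀_F} (‖y‖²)⁻¹ · ∫⁻_{K_U} ‖f(k⁻¹ (z n(θ(y⁻¹))) k)‖ dμ_K dμ_F(y) < ∞` — the `dm`-integral of `Σ_t |ψ(t α₃(m)⁻¹ δ₀)|`
over `N E^*∖N I_E` unfolded to `𝕀_F`, an absolutely convergent Tate integral at `|·|²` (★
`lintegral_enorm_comp_inv_mul_ideleNorm_rpow_neg_lt_top` at `σ = 2`). [cite: Rogawski1990, §7.3 (7.3.2) and Prop. 7.3.2 (c), (d) (p. 97; (7.3.2) p. 98)]
[cite: CasselsFrohlichANT1967, Ch. XV Lemma 4.2.4 and Thm. 4.3.2] -/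
theorem lintegral_ideleNorm_sq_inv_mul_centreProfile_lt_top (hc : c * c = 1) {δ : E} (hcδ : c δ = -δ) (hδ : δ ≠ 0)
    (z : (quasiSplit F E c 3).Adelic)
    (μK : Measure ((standardMaximalCompactGL 3 E).comap
      (adelicVal F E c 3 ((StdForm.antidiagonal 3).over E)) : Subgroup (quasiSplit F E c 3).Adelic))
    [μK.IsHaarMeasure] (μF : Measure (AdeleRing (𝓞 F) F)ˣ) [IsHaarMeasure μF]
    {f : (quasiSplit F E c 3).Adelic → ℂ} (hfc : Continuous f) (hf : HasCompactSupport f) :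
    ∫⁻ y, (((IdeleClassGroup.ideleNorm F y ^ 2)⁻¹ : ℝ≥0) : ℝ≥0∞) *
      ∫⁻ k, ‖f ((k : (quasiSplit F E c 3).Adelic)⁻¹ * (z *
        ((heisChart hc ((0 : AdeleRing (𝓞 E) E),
            traceZeroLine F E c hcδ hδ (((y⁻¹ : (AdeleRing (𝓞 F) F)ˣ)) : AdeleRing (𝓞 F) F)) :
          adelicUnipotent F E c 3) : (quasiSplit F E c 3).Adelic)) * (k : (quasiSplit F E c 3).Adelic))‖ₑ ∂μK ∂μF < ∞ := by
  -- move to Mathlib's pulled-back σ-algebra over `borel 𝔸_F` (both are the Borel σ-algebra of `𝕀_F`)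
  letI mA : MeasurableSpace (AdeleRing (𝓞 F) F) := borel _
  haveI hA : BorelSpace (AdeleRing (𝓞 F) F) := ⟨rfl⟩
  have hD : (Units.instMeasurableSpace : MeasurableSpace (AdeleRing (𝓞 F) F)ˣ) = ‹MeasurableSpace (AdeleRing (𝓞 F) F)ˣ› := by
    rw [(borelSpace_ideleGroup F).measurable_eq, ‹BorelSpace (AdeleRing (𝓞 F) F)ˣ›.measurable_eq]
  subst hD
  -- the absolute profile on `𝔸_F` is continuous, non-negative, of compact support
  have hK : IsCompact (((standardMaximalCompactGL 3 E).comap (adelicVal F E c 3 ((StdForm.antidiagonal 3).over E)) :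
      Subgroup (quasiSplit F E c 3).Adelic) : Set (quasiSplit F E c 3).Adelic) :=
    isCompact_comap_adelicVal_standardMaximalCompactGL
  haveI := isFiniteMeasure_of_isHaarMeasure_KU (F := F) (E := E) (c := c) μK
  haveI : CompactSpace ((standardMaximalCompactGL 3 E).comap (adelicVal F E c 3 ((StdForm.antidiagonal 3).over E)) :
      Subgroup (quasiSplit F E c 3).Adelic) := isCompact_iff_compactSpace.1 hK
  haveI : BorelSpace ((standardMaximalCompactGL 3 E).comap (adelicVal F E c 3 ((StdForm.antidiagonal 3).over E)) :
      Subgroup (quasiSplit F E c 3).Adelic) := Subtype.borelSpace _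
  have hΨc := continuous_integral_norm_conj_heisChart_traceZeroLine hc hcδ hδ z hK μK hfc
  have hΨs := hasCompactSupport_integral_norm_conj_heisChart_traceZeroLine hc hcδ hδ z hK μK hf
  have hT := lintegral_enorm_comp_inv_mul_ideleNorm_rpow_neg_lt_top F μF hΨc hΨs one_lt_two
  refine lt_of_le_of_lt (le_of_eq (lintegral_congr fun y => ?_)) hT
  -- pointwise: `(‖y‖²)⁻¹ · ∫⁻ ‖·‖ₑ = ‖Ψ(y⁻¹)‖ₑ · ‖y‖^(-2)`
  have hint : Integrable (fun k : ((standardMaximalCompactGL 3 E).comap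
      (adelicVal F E c 3 ((StdForm.antidiagonal 3).over E)) : Subgroup (quasiSplit F E c 3).Adelic) =>
      f ((k : (quasiSplit F E c 3).Adelic)⁻¹ * (z *
        ((heisChart hc ((0 : AdeleRing (𝓞 E) E),
            traceZeroLine F E c hcδ hδ (((y⁻¹ : (AdeleRing (𝓞 F) F)ˣ)) : AdeleRing (𝓞 F) F)) :
          adelicUnipotent F E c 3) : (quasiSplit F E c 3).Adelic)) * (k : (quasiSplit F E c 3).Adelic))) μK := by
    have hcont : Continuous fun k : ((standardMaximalCompactGL 3 E).comap
        (adelicVal F E c 3 ((StdForm.antidiagonal 3).over E)) : Subgroup (quasiSplit F E c 3).Adelic) =>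
        f ((k : (quasiSplit F E c 3).Adelic)⁻¹ * (z *
          ((heisChart hc ((0 : AdeleRing (𝓞 E) E),
              traceZeroLine F E c hcδ hδ (((y⁻¹ : (AdeleRing (𝓞 F) F)ˣ)) : AdeleRing (𝓞 F) F)) :
            adelicUnipotent F E c 3) : (quasiSplit F E c 3).Adelic)) * (k : (quasiSplit F E c 3).Adelic)) :=
      hfc.comp ((continuous_subtype_val.inv.mul continuous_const).mul continuous_subtype_val)
    exact integrableOn_univ.1 (hcont.continuousOn.integrableOn_compact' isCompact_univ MeasurableSet.univ)
  have hnn : 0 ≤ ∫ k, ‖f ((k : (quasiSplit F E c 3).Adelic)⁻¹ * (z *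
      ((heisChart hc ((0 : AdeleRing (𝓞 E) E),
          traceZeroLine F E c hcδ hδ (((y⁻¹ : (AdeleRing (𝓞 F) F)ˣ)) : AdeleRing (𝓞 F) F)) :
        adelicUnipotent F E c 3) : (quasiSplit F E c 3).Adelic)) * (k : (quasiSplit F E c 3).Adelic))‖ ∂μK :=
    integral_nonneg fun _ => norm_nonneg _
  rw [coe_ideleNorm_sq_inv_eq_ofReal_rpow, mul_comm, ← ofReal_integral_norm_eq_lintegral_enorm hint,
    Real.enorm_eq_ofReal hnn]

/-- **`hHfin`** — the same over any Borel set `S ⊆ 𝕀_F` (for the (C-γ) assembly: `S = ↑(F^* ⊔ N I_E)`, `z = ι(z₁)`):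
`∫⁻_{y ∈ S} (‖y‖²)⁻¹ · ∫⁻_{K_U} ‖f(k⁻¹ (z n(θ(y⁻¹))) k)‖ dμ_K dμ_F < ∞`.
[cite: Rogawski1990, §7.3 (7.3.2) and Prop. 7.3.2 (c), (d) (p. 97; (7.3.2) p. 98)] -/
theorem setLIntegral_ideleNorm_sq_inv_mul_centreProfile_lt_top (hc : c * c = 1) {δ : E} (hcδ : c δ = -δ)
    (hδ : δ ≠ 0) (z : (quasiSplit F E c 3).Adelic)
    (μK : Measure ((standardMaximalCompactGL 3 E).comap
      (adelicVal F E c 3 ((StdForm.antidiagonal 3).over E)) : Subgroup (quasiSplit F E c 3).Adelic))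
    [μK.IsHaarMeasure] (μF : Measure (AdeleRing (𝓞 F) F)ˣ) [IsHaarMeasure μF]
    {f : (quasiSplit F E c 3).Adelic → ℂ} (hfc : Continuous f) (hf : HasCompactSupport f)
    (S : Set (AdeleRing (𝓞 F) F)ˣ) :
    ∫⁻ y in S, (((IdeleClassGroup.ideleNorm F y ^ 2)⁻¹ : ℝ≥0) : ℝ≥0∞) *
      ∫⁻ k, ‖f ((k : (quasiSplit F E c 3).Adelic)⁻¹ * (z *
        ((heisChart hc ((0 : AdeleRing (𝓞 E) E),
            traceZeroLine F E c hcδ hδ (((y⁻¹ : (AdeleRing (𝓞 F) F)ˣ)) : AdeleRing (𝓞 F) F)) :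
          adelicUnipotent F E c 3) : (quasiSplit F E c 3).Adelic)) * (k : (quasiSplit F E c 3).Adelic))‖ₑ ∂μK ∂μF < ∞ :=
  lt_of_le_of_lt (setLIntegral_le_lintegral S _)
    (lintegral_ideleNorm_sq_inv_mul_centreProfile_lt_top hc hcδ hδ z μK μF hfc hf)

/-- **THE WEIGHTED CENTRE PROFILE IS `μ_F`-INTEGRABLE**: `y ↦ (‖y‖²)⁻¹ • ∫_{K_U} f(k⁻¹ (z n(θ(y⁻¹))) k) dμ_K ∈ L¹(𝕀_F, μ_F)`
for `f` continuous of compact support (★ `integrable_ideleNorm_rpow_neg_smul_comp_inv` at `σ = 2` for the continuous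
compactly supported profile on `𝔸_F`). [cite: Rogawski1990, §7.3 (7.3.2) and Prop. 7.3.2 (c), (d) (p. 97; (7.3.2) p. 98)]
[cite: CasselsFrohlichANT1967, Ch. XV Lemma 4.2.4 and Thm. 4.3.2] -/
theorem integrable_ideleNorm_sq_inv_smul_centreProfile (hc : c * c = 1) {δ : E} (hcδ : c δ = -δ) (hδ : δ ≠ 0)
    (z : (quasiSplit F E c 3).Adelic)
    (μK : Measure ((standardMaximalCompactGL 3 E).comap
      (adelicVal F E c 3 ((StdForm.antidiagonal 3).over E)) : Subgroup (quasiSplit F E c 3).Adelic))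
    [μK.IsHaarMeasure] (μF : Measure (AdeleRing (𝓞 F) F)ˣ) [IsHaarMeasure μF]
    {f : (quasiSplit F E c 3).Adelic → ℂ} (hfc : Continuous f) (hf : HasCompactSupport f) :
    Integrable (fun y : (AdeleRing (𝓞 F) F)ˣ => (((IdeleClassGroup.ideleNorm F y ^ 2)⁻¹ : ℝ≥0) : ℝ) •
      ∫ k, f ((k : (quasiSplit F E c 3).Adelic)⁻¹ * (z *
        ((heisChart hc ((0 : AdeleRing (𝓞 E) E),
            traceZeroLine F E c hcδ hδ (((y⁻¹ : (AdeleRing (𝓞 F) F)ˣ)) : AdeleRing (𝓞 F) F)) :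
          adelicUnipotent F E c 3) : (quasiSplit F E c 3).Adelic)) * (k : (quasiSplit F E c 3).Adelic)) ∂μK) μF := by
  letI mA : MeasurableSpace (AdeleRing (𝓞 F) F) := borel _
  haveI hA : BorelSpace (AdeleRing (𝓞 F) F) := ⟨rfl⟩
  have hD : (Units.instMeasurableSpace : MeasurableSpace (AdeleRing (𝓞 F) F)ˣ) = ‹MeasurableSpace (AdeleRing (𝓞 F) F)ˣ› := by
    rw [(borelSpace_ideleGroup F).measurable_eq, ‹BorelSpace (AdeleRing (𝓞 F) F)ˣ›.measurable_eq]
  subst hD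
  have hK : IsCompact (((standardMaximalCompactGL 3 E).comap (adelicVal F E c 3 ((StdForm.antidiagonal 3).over E)) :
      Subgroup (quasiSplit F E c 3).Adelic) : Set (quasiSplit F E c 3).Adelic) :=
    isCompact_comap_adelicVal_standardMaximalCompactGL
  haveI := isFiniteMeasure_of_isHaarMeasure_KU (F := F) (E := E) (c := c) μK
  have hΨc := continuous_integral_conj_heisChart_traceZeroLine hc hcδ hδ z hK μK hfc
  have hΨs := hasCompactSupport_integral_conj_heisChart_traceZeroLine hc hcδ hδ z hK μK hf
  have hT := integrable_ideleNorm_rpow_neg_smul_comp_inv F μF hΨc hΨs one_lt_two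
  refine hT.congr (Filter.Eventually.of_forall fun y => ?_)
  simp only [coe_ideleNorm_sq_inv_eq_rpow]

/-- **`IntegrableOn (‖·‖⁻² • Φ_f) S μ_F`** for any `S ⊆ 𝕀_F` (for the (C-γ) assembly (B): `S = ↑(F^* ⊔ N I_E)`).
[cite: Rogawski1990, §7.3 (7.3.2) and Prop. 7.3.2 (c), (d) (p. 97; (7.3.2) p. 98)] -/
theorem integrableOn_ideleNorm_sq_inv_smul_centreProfile (hc : c * c = 1) {δ : E} (hcδ : c δ = -δ) (hδ : δ ≠ 0)
    (z : (quasiSplit F E c 3).Adelic)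
    (μK : Measure ((standardMaximalCompactGL 3 E).comap
      (adelicVal F E c 3 ((StdForm.antidiagonal 3).over E)) : Subgroup (quasiSplit F E c 3).Adelic))
    [μK.IsHaarMeasure] (μF : Measure (AdeleRing (𝓞 F) F)ˣ) [IsHaarMeasure μF]
    {f : (quasiSplit F E c 3).Adelic → ℂ} (hfc : Continuous f) (hf : HasCompactSupport f)
    (S : Set (AdeleRing (𝓞 F) F)ˣ) :
    IntegrableOn (fun y : (AdeleRing (𝓞 F) F)ˣ => (((IdeleClassGroup.ideleNorm F y ^ 2)⁻¹ : ℝ≥0) : ℝ) •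
      ∫ k, f ((k : (quasiSplit F E c 3).Adelic)⁻¹ * (z *
        ((heisChart hc ((0 : AdeleRing (𝓞 E) E),
            traceZeroLine F E c hcδ hδ (((y⁻¹ : (AdeleRing (𝓞 F) F)ˣ)) : AdeleRing (𝓞 F) F)) :
          adelicUnipotent F E c 3) : (quasiSplit F E c 3).Adelic)) * (k : (quasiSplit F E c 3).Adelic)) ∂μK) S μF :=
  (integrable_ideleNorm_sq_inv_smul_centreProfile hc hcδ hδ z μK μF hfc hf).integrableOn

/-- **Letter form** with an abstract profile `Φ` and its defining identity `hΦ` (the letters of ★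
`integral_tsum_centre_torus_mul_eq_tsum_principalIdeles`): `y ↦ (‖y‖²)⁻¹ • Φ y ∈ L¹(μ_F)`.
[cite: Rogawski1990, §7.3 (7.3.2) and Prop. 7.3.2 (c), (d) (p. 97; (7.3.2) p. 98)] -/
theorem integrable_ideleNorm_sq_inv_smul_of_eq_centreProfile (hc : c * c = 1) {δ : E} (hcδ : c δ = -δ) (hδ : δ ≠ 0)
    (z : (quasiSplit F E c 3).Adelic)
    (μK : Measure ((standardMaximalCompactGL 3 E).comap
      (adelicVal F E c 3 ((StdForm.antidiagonal 3).over E)) : Subgroup (quasiSplit F E c 3).Adelic))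
    [μK.IsHaarMeasure] (μF : Measure (AdeleRing (𝓞 F) F)ˣ) [IsHaarMeasure μF]
    {f : (quasiSplit F E c 3).Adelic → ℂ} (hfc : Continuous f) (hf : HasCompactSupport f)
    (Φ : (AdeleRing (𝓞 F) F)ˣ → ℂ)
    (hΦ : ∀ y, Φ y = ∫ k, f ((k : (quasiSplit F E c 3).Adelic)⁻¹ * (z *
        ((heisChart hc ((0 : AdeleRing (𝓞 E) E),
            traceZeroLine F E c hcδ hδ (((y⁻¹ : (AdeleRing (𝓞 F) F)ˣ)) : AdeleRing (𝓞 F) F)) :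
          adelicUnipotent F E c 3) : (quasiSplit F E c 3).Adelic)) * (k : (quasiSplit F E c 3).Adelic)) ∂μK) :
    Integrable (fun y : (AdeleRing (𝓞 F) F)ˣ => (((IdeleClassGroup.ideleNorm F y ^ 2)⁻¹ : ℝ≥0) : ℝ) • Φ y) μF := by
  have h := integrable_ideleNorm_sq_inv_smul_centreProfile hc hcδ hδ z μK μF hfc hf
  refine h.congr (Filter.Eventually.of_forall fun y => ?_)
  simp only [hΦ y]

/-- **Letter form, on a set**: `IntegrableOn (‖·‖⁻² • Φ) S μ_F` for an abstract profile `Φ` with its defining identity.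
[cite: Rogawski1990, §7.3 (7.3.2) and Prop. 7.3.2 (c), (d) (p. 97; (7.3.2) p. 98)] -/
theorem integrableOn_ideleNorm_sq_inv_smul_of_eq_centreProfile (hc : c * c = 1) {δ : E} (hcδ : c δ = -δ)
    (hδ : δ ≠ 0) (z : (quasiSplit F E c 3).Adelic)
    (μK : Measure ((standardMaximalCompactGL 3 E).comap
      (adelicVal F E c 3 ((StdForm.antidiagonal 3).over E)) : Subgroup (quasiSplit F E c 3).Adelic))
    [μK.IsHaarMeasure] (μF : Measure (AdeleRing (𝓞 F) F)ˣ) [IsHaarMeasure μF]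
    {f : (quasiSplit F E c 3).Adelic → ℂ} (hfc : Continuous f) (hf : HasCompactSupport f)
    (Φ : (AdeleRing (𝓞 F) F)ˣ → ℂ)
    (hΦ : ∀ y, Φ y = ∫ k, f ((k : (quasiSplit F E c 3).Adelic)⁻¹ * (z *
        ((heisChart hc ((0 : AdeleRing (𝓞 E) E),
            traceZeroLine F E c hcδ hδ (((y⁻¹ : (AdeleRing (𝓞 F) F)ˣ)) : AdeleRing (𝓞 F) F)) :
          adelicUnipotent F E c 3) : (quasiSplit F E c 3).Adelic)) * (k : (quasiSplit F E c 3).Adelic)) ∂μK)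
    (S : Set (AdeleRing (𝓞 F) F)ˣ) :
    IntegrableOn (fun y : (AdeleRing (𝓞 F) F)ˣ => (((IdeleClassGroup.ideleNorm F y ^ 2)⁻¹ : ℝ≥0) : ℝ) • Φ y) S μF :=
  (integrable_ideleNorm_sq_inv_smul_of_eq_centreProfile hc hcδ hδ z μK μF hfc hf Φ hΦ).integrableOn

end Idele

end UnitaryGroup

end Literature.NumberTheory.Automorphic
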